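import Literature.Probability.Percolation.ArmSeparationInnerFrames
import Literature.Probability.Percolation.ArmSeparationExtArm
import HarnessLib

/-!
# The internal separation step: externally landed arms are fenced at their inner ends, or the annulus fails

Topic: Probability / Percolation; family `crit-perc` (`P = P_{1/2} = triSitePercolation half`). A
brick of the discharge of `Literature.Probability.Percolation.Nolin2008_twoArm_separation`
(Nolin 2008, Thm. 11 [arXiv 0711.4948: Thm. 10], `j = 2`, `σ = BW`; `ArmSeparation.lean`): the step
`f (K+1) ≤ g (K+1) + ε · f K` of the multi-scale scheme (`ArmSeparationScheme.lean`) for the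
INTERNAL extremities (Nolin 2008, §4.4, p. 13: the events `Ã̃^{·/η'₀,I}(2^{k+i}, 2^K)`, arms landed
on `∂S_{2^K}`, are made well-separated on `∂S_{2^{k+i}}` "from `∂S_{2^k}` toward the interior",
except on an event of probability `4δ` independent of `Ã̃(2^{k+i+1}, 2^K)`). In Lean, with
`extTwoArm m N` the two arms landed on `∂Λ_N` only (`ArmSeparationExtArm.lean`):

* `IntTinyExt m N k₀ K R₀` — **the output of the surgery**: the outer free spaces of the two arms
  and, in two frames `io, ic < 6` (`ArmSeparationInnerFrames.lean`), fenced inner tips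
  (`IntFencedArm`: middle tip, scale `k₀ · 32^j`, fenced protected tip, paths) whose far ends are
  the outer attaching sites;
* `extTwoArm_inter_inGoodF_subset` — **surgery**: `extTwoArm m N ∩ InGoodF ⊆ IntTinyExt`
  (`exists_two_intFencedArm_frames`);
* `determinedBy_setOf_inGoodF` — **locality**: `InGoodF m …` is determined by the sites of
  `Λ_{2m}` (the exploration domains, fence zones and corner guards lie there when `64 k < m`,
  `32 R < m`), while `extTwoArm (2m+1) N` is determined by the sites of norm `≥ 2m + 1`
  (`determinedBy_extTwoArm`); hence
* `real_extTwoArm_le_step` — **the step inequality**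
  `P(extTwoArm m N) ≤ P(IntTinyExt m N k₀ K R₀) + P(¬ InGoodF m …) · P(extTwoArm (2m+1) N)`
  (union bound, monotonicity in the inner radius, and the product formula for events determined
  by disjoint site sets).

## References

* P. Nolin, *Near-critical percolation in two dimensions*, Electron. J. Probab. 13 (2008), §4.4,
  proof of Thm. 11, internal extremities [arXiv 0711.4948: Thm. 10, p. 12–13]. [Nolin2008]
* H. Kesten, *Scaling relations for 2D-percolation*, Comm. Math. Phys. 109 (1987), Lemma 2. [Kesten1987]
-/

noncomputable section

open MeasureTheory Set

namespace Literature.Probability.Percolation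

open LatticeModels HalfAnnulus

/-! ### The output event of the surgery -/

/-- **Externally landed arms, fenced at their inner ends** (Nolin's `Ã^{η, ·/η'₀, I}` at the
microscopic inner separation, before the inward extension): landing sites `z_o, z_c ∈ sepLanding N`
with outer free spaces crossed through `u_o` (open sites of `ω`) and `u_c` (open sites of
`negFlip ω`), and, in frames `io, ic < 6`, a fenced open arm of `frameConfig io ω` in the region
`(frameIso io)⁻¹({m ≤ |v| ≤ N} ∪ S̊_{N/8}(z_o))` with far end `(frameIso io)⁻¹ u_o`, and a fenced
closed arm (open arm of `(frameConfig ic ω)ᶜ`) in `(frameIso ic)⁻¹(-( {m ≤ |v| ≤ N} ∪ S̊_{N/8}(z_c) ))`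
with far end `(frameIso ic)⁻¹ (-u_c)`. [cite: Nolin2008, §4.4 (arXiv 0711.4948: proof of Thm. 10, p. 13)] -/
def IntTinyExt (m N k₀ K R₀ : ℕ) : Set (SiteConfig (Site 2)) :=
  {ω | ∃ zo uo zc uc : Site 2, zo ∈ sepLanding N ∧ zc ∈ sepLanding N ∧
    OpenVCrossThrough (sepOuterFence N zo) (zo 1 - (N / 64 : ℕ)) (zo 1 + (N / 64 : ℕ)) ω uo ∧
    OpenVCrossThrough (sepOuterFence N zc) (zc 1 - (N / 64 : ℕ)) (zc 1 + (N / 64 : ℕ)) (negFlip ω) uc ∧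
    ∃ io < 6, ∃ ic < 6,
      (∃ Fo : IntFencedArm m ((frameIso io).symm '' (triAnnulusSet m N ∪ triOpenBall zo (N / 8))) k₀ K R₀ (frameConfig io ω),
          Fo.b = (frameIso io).symm uo) ∧
      ∃ Fc : IntFencedArm m ((frameIso ic).symm '' (Neg.neg ⁻¹' (triAnnulusSet m N ∪ triOpenBall zc (N / 8)))) k₀ K R₀
          (frameConfig ic ω)ᶜ, Fc.b = (frameIso ic).symm (-uc)}

/-! ### Surgery -/

/-- The arm region of an externally landed arm consists of sites of norm `≥ m` (`2m ≤ N`). [folklore] -/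
theorem norm_le_of_mem_extRegion {m N : ℕ} (hN : 2 * m ≤ N) {z : Site 2} (hz : z ∈ sepLanding N) :
    ∀ v ∈ triAnnulusSet m N ∪ triOpenBall z (N / 8), (m : ℤ) ≤ triNorm v := by
  rw [mem_sepLanding] at hz
  have hN' : 2 * (m : ℤ) ≤ N := by exact_mod_cast hN
  rintro v (hv | hv)
  · exact (mem_triAnnulusSet.1 hv).1
  · rw [mem_triOpenBall, triNorm_lt_iff_lin] at hv
    simp only [Pi.sub_apply] at hv
    exact le_triNorm_iff_lin.2 (Or.inl (by omega))

/-- The arm region contains the annulus `{m ≤ |v| ≤ 2m}` (`2m ≤ N`). [folklore] -/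
theorem triAnnSet_subset_extRegion {m N : ℕ} (hN : 2 * m ≤ N) (z : Site 2) :
    triAnnSet m (2 * m) ⊆ triAnnulusSet m N ∪ triOpenBall z (N / 8) := by
  intro v hv
  rw [mem_triAnnSet] at hv
  have hN' : ((2 * m : ℕ) : ℤ) ≤ N := by exact_mod_cast hN
  exact Or.inl ⟨hv.1, hv.2.trans hN'⟩

/-- **Surgery at the inner boundary** (Nolin 2008, §4.4, internal extremities): on `InGoodF`, two
arms landed on `∂Λ_N` are fenced at their inner ends on `∂Λ_m` (`m ≥ 5`, `2m < N`, `R₀ ≥ 2`,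
`4 · R₀ 32^i < m` for `i < Kg`): `extTwoArm m N ∩ InGoodF ⊆ IntTinyExt m N k₀ K R₀`. The closed
arm of `negFlip ω` is read as a closed path of `ω` in the reflected region
(`exists_closed_path_of_negFlip_mem_extOpenArm`), and `exists_two_intFencedArm_frames` applies. [cite: Nolin2008, §4.4 (arXiv 0711.4948: proof of Thm. 10, p. 13)] -/
theorem extTwoArm_inter_inGoodF_subset {m N T k₀ K R₀ Kg : ℕ} (hm : 5 ≤ m) (hN : 2 * m < N) (hR₀ : 2 ≤ R₀)
    (hRg : ∀ i < Kg, 4 * trapScale R₀ i < m) :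
    extTwoArm m N ∩ {ω | InGoodF m T k₀ K R₀ Kg ω} ⊆ IntTinyExt m N k₀ K R₀ := by
  rintro ω ⟨⟨hO, hC⟩, hgood⟩
  obtain ⟨zo, uo, ao, hzo, hao, hOuto, Po⟩ := hO
  obtain ⟨zc, uc, ac, hzc, hac, hOutc, Pc⟩ := exists_closed_path_of_negFlip_mem_extOpenArm hC
  have huo : 2 * (m : ℤ) < triNorm uo := by
    obtain ⟨b', t', -, -, q, -⟩ := hOuto
    have := lt_triNorm_of_mem_sepOuterFence q.right_mem.1
    omega
  have huc : 2 * (m : ℤ) < triNorm (-uc) := by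
    obtain ⟨b', t', -, -, q, -⟩ := hOutc
    have := lt_triNorm_of_mem_sepOuterFence q.right_mem.1
    rw [triNorm_neg]; omega
  have hAo := norm_le_of_mem_extRegion hN.le hzo
  have hAc : ∀ v ∈ Neg.neg ⁻¹' (triAnnulusSet m N ∪ triOpenBall zc (N / 8)), (m : ℤ) ≤ triNorm v := fun v hv => by
    have := norm_le_of_mem_extRegion hN.le hzc (-v) hv
    rwa [triNorm_neg] at this
  have hAo' := triAnnSet_subset_extRegion hN.le zo
  have hAc' : triAnnSet m (2 * m) ⊆ Neg.neg ⁻¹' (triAnnulusSet m N ∪ triOpenBall zc (N / 8)) := fun v hv => by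
    refine triAnnSet_subset_extRegion hN.le zc ?_
    rw [mem_triAnnSet, triNorm_neg]; exact mem_triAnnSet.1 hv
  obtain ⟨io, hio, ic, hic, hFo, hFc⟩ := exists_two_intFencedArm_frames hm hR₀ hRg hgood hAo hAo' hAc hAc'
    hao huo Po (by rw [triNorm_neg]; exact hac) huc Pc
  exact ⟨zo, uo, zc, uc, hzo, hzc, hOuto, hOutc, io, hio, ic, hic, hFo, hFc⟩

/-! ### Locality of the good event -/

section Locality

variable {m : ℕ}

/-- Paths inside a set of sites of norm `≤ 2m` only depend on the configuration on `Λ_{2m}`. [folklore] -/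
theorem pathIn_congr_ball {T : Set (Site 2)} (hT : ∀ v ∈ T, triNorm v ≤ 2 * (m : ℤ)) {χ χ' : Set (Site 2)}
    (hagree : ∀ v : Site 2, triNorm v ≤ 2 * (m : ℤ) → (v ∈ χ ↔ v ∈ χ')) {x y : Site 2} :
    PathIn triGraph (T ∩ χ) x y ↔ PathIn triGraph (T ∩ χ') x y :=
  ⟨fun h => h.mono fun v hv => ⟨hv.1, (hagree v (hT v hv.1)).1 hv.2⟩,
    fun h => h.mono fun v hv => ⟨hv.1, (hagree v (hT v hv.1)).2 hv.2⟩⟩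

/-- The complements of two configurations agreeing on `Λ_{2m}` agree there. [folklore] -/
theorem compl_agree {χ χ' : Set (Site 2)} (hagree : ∀ v : Site 2, triNorm v ≤ 2 * (m : ℤ) → (v ∈ χ ↔ v ∈ χ')) :
    ∀ v : Site 2, triNorm v ≤ 2 * (m : ℤ) → (v ∈ χᶜ ↔ v ∈ χ'ᶜ) := fun v hv => not_congr (hagree v hv)

/-- **Locality of the per-scale success**: for a tip `z` of the tip arc and a scale `k` with
`64k < m`, `IntFenceOK m c z k` only depends on the configuration on `Λ_{2m}` (the fence box, the
fence zone and the half-annulus lie there). [folklore] -/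
theorem intFenceOK_congr {c : Finset (Site 2)} {z : Site 2} {k : ℕ} (hz : IsIntJ m z) (hk : 64 * k < m)
    {χ χ' : Set (Site 2)} (hagree : ∀ v : Site 2, triNorm v ≤ 2 * (m : ℤ) → (v ∈ χ ↔ v ∈ χ')) :
    IntFenceOK m c z k χ ↔ IntFenceOK m c z k χ' := by
  obtain ⟨hz0, hz1, hz2⟩ := hz
  have hk' : 64 * (k : ℤ) < m := by exact_mod_cast hk
  have hstrip : ∀ v ∈ triStrip (z 0 - 2 * k) (z 1 + k) k k, triNorm v ≤ 2 * (m : ℤ) := fun v hv => by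
    rw [mem_triStrip] at hv; exact triNorm_le_iff_lin.2 (by omega)
  have hzone : ∀ v ∈ intFrameZone m z k, triNorm v ≤ 2 * (m : ℤ) := fun v hv => by
    rw [mem_intFrameZone] at hv; exact triNorm_le_iff_lin.2 (by omega)
  have hha : ∀ v ∈ haSet m, triNorm v ≤ 2 * (m : ℤ) := fun v hv => (mem_haSet.1 hv).2.2
  unfold IntFenceOK OpenVCrossThrough
  simp only [pathIn_congr_ball hstrip hagree, pathIn_congr_ball hzone hagree, pathIn_congr_ball hha (compl_agree hagree)]

/-- **Locality of the failure event**: `InFail m T k₀ K R₀` only depends on the configuration on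
`Λ_{2m}` (`m ≥ 5`, `64 k_j < m` for `j < K`): the exploration sequence depends on the half-annulus
(`JDomain.lowestSeq_congr`) and the per-scale successes on `Λ_{2m}` (`intFenceOK_congr`). [folklore] -/
theorem inFail_congr {T k₀ K R₀ : ℕ} (hm : 5 ≤ m) (hKm : ∀ j < K, 64 * trapScale k₀ j < m) {χ χ' : Set (Site 2)}
    (hagree : ∀ v : Site 2, triNorm v ≤ 2 * (m : ℤ) → (v ∈ χ ↔ v ∈ χ')) :
    InFail m T k₀ K R₀ χ ↔ InFail m T k₀ K R₀ χ' := by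
  have hcut := intDom_cutProp hm
  have hdual := intDom_dualProp hm
  -- the exploration sequences agree
  have hseq : ∀ u (c : Finset (Site 2)) (z : Site 2),
      (intDom m).lowestSeq χ u = some (c, z) ↔ (intDom m).lowestSeq χ' u = some (c, z) := by
    intro u c z
    have key : ∀ χ₁ χ₂ : Set (Site 2), (∀ v : Site 2, triNorm v ≤ 2 * (m : ℤ) → (v ∈ χ₁ ↔ v ∈ χ₂)) →
        (intDom m).lowestSeq χ₁ u = some (c, z) → (intDom m).lowestSeq χ₂ u = some (c, z) := by
      intro χ₁ χ₂ h12 h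
      have hc := (JDomain.isCrossing_of_lowestSeq h).1
      refine (JDomain.lowestSeq_congr hcut hdual fun v hv => h12 v ?_).1 h
      have hvD := JDomain.lower_subset_D hc.subset hv
      rw [intDom_D, mem_haFin] at hvD
      exact hvD.2.2
    exact ⟨key χ χ' hagree, key χ' χ fun v hv => (hagree v hv).symm⟩
  have hnone : (intDom m).lowestSeq χ T = none ↔ (intDom m).lowestSeq χ' T = none := by
    constructor
    · intro h
      by_contra h'
      obtain ⟨⟨c, z⟩, hp⟩ := Option.ne_none_iff_exists'.1 h'
      rw [← hseq] at hp
      rw [h] at hp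
      exact absurd hp (by simp)
    · intro h
      by_contra h'
      obtain ⟨⟨c, z⟩, hp⟩ := Option.ne_none_iff_exists'.1 h'
      rw [hseq] at hp
      rw [h] at hp
      exact absurd hp (by simp)
  unfold InFail IntSeqFail
  refine or_congr (not_congr hnone) ?_
  refine exists_congr fun u => and_congr_right fun _ => exists_congr fun c => exists_congr fun z => ?_
  refine ⟨fun ⟨h1, h2, h3⟩ => ⟨(hseq u c z).1 h1, h2, fun j hj => ?_⟩, fun ⟨h1, h2, h3⟩ => ⟨(hseq u c z).2 h1, h2, fun j hj => ?_⟩⟩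
  · have hz : IsIntJ m z := (mem_intDom_J.1 (JDomain.isCrossing_of_lowestSeq h1).1.tip_mem_J).2
    rw [← intFenceOK_congr hz (hKm j hj) hagree]; exact h3 j hj
  · have hz : IsIntJ m z := (mem_intDom_J.1 (JDomain.isCrossing_of_lowestSeq h1).1.tip_mem_J).2
    rw [intFenceOK_congr hz (hKm j hj) hagree]; exact h3 j hj

/-- **Locality of a corner guard**: `InGuard R₀ Kg C` only depends on the configuration on
`Λ_{2m}` when the point `C` has norm `m` and `32 · R₀ 32^i ≤ m` for `i < Kg` (the annuli of
`trapRSW C R` lie within `16R` of `C`). [folklore] -/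
theorem inGuard_congr {R₀ Kg : ℕ} {C : Site 2} (hC : triNorm C = m) (hRg : ∀ i < Kg, 32 * trapScale R₀ i ≤ m)
    {χ χ' : Set (Site 2)} (hagree : ∀ v : Site 2, triNorm v ≤ 2 * (m : ℤ) → (v ∈ χ ↔ v ∈ χ')) :
    InGuard R₀ Kg C χ ↔ InGuard R₀ Kg C χ' := by
  have hCle := triNorm_le_iff_lin.1 hC.le
  have key : ∀ i < Kg, (χᶜ ∈ trapRSW C (trapScale R₀ i) ↔ χ'ᶜ ∈ trapRSW C (trapScale R₀ i)) := by
    intro i hi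
    have hR : 32 * (trapScale R₀ i : ℤ) ≤ m := by exact_mod_cast hRg i hi
    refine (determinedBy_iff _ _).1 (determinedBy_trapRSW C (trapScale R₀ i)) χᶜ χ'ᶜ (Set.ext fun v => ?_)
    simp only [Set.mem_inter_iff, Finset.mem_coe, mem_triSqAnnulusFinset]
    constructor
    · rintro ⟨h1, h2⟩
      refine ⟨(compl_agree hagree v ?_).1 h1, h2⟩
      push_cast at h2
      exact triNorm_le_iff_lin.2 (by omega)
    · rintro ⟨h1, h2⟩
      refine ⟨(compl_agree hagree v ?_).2 h1, h2⟩
      push_cast at h2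
      exact triNorm_le_iff_lin.2 (by omega)
  unfold InGuard
  exact exists_congr fun i => and_congr_right fun hi => key i hi

/-- **Locality of the good event**: `InGoodF m T k₀ K R₀ Kg` only depends on the configuration on
`Λ_{2m}` (`m ≥ 5`, `64 k_j < m`, `32 · R₀ 32^i ≤ m`; the frames preserve `Λ_{2m}`). [folklore] -/
theorem inGoodF_congr {T k₀ K R₀ Kg : ℕ} (hm : 5 ≤ m) (hKm : ∀ j < K, 64 * trapScale k₀ j < m)
    (hRg : ∀ i < Kg, 32 * trapScale R₀ i ≤ m) {ω ω' : Set (Site 2)}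
    (hagree : ∀ v : Site 2, triNorm v ≤ 2 * (m : ℤ) → (v ∈ ω ↔ v ∈ ω')) :
    InGoodF m T k₀ K R₀ Kg ω ↔ InGoodF m T k₀ K R₀ Kg ω' := by
  have hm1 : triNorm (![(m : ℤ), -(m : ℤ)] : Site 2) = m := by
    refine le_antisymm (triNorm_le_iff_lin.2 ?_) (le_triNorm_iff_lin.2 (Or.inl ?_)) <;>
      simp only [site_mk_apply_zero, site_mk_apply_one] <;> omega
  have hm2 : triNorm (![(m : ℤ), 0] : Site 2) = m := by
    refine le_antisymm (triNorm_le_iff_lin.2 ?_) (le_triNorm_iff_lin.2 (Or.inl ?_)) <;>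
      simp only [site_mk_apply_zero, site_mk_apply_one] <;> omega
  have hfr : ∀ i < 6, ∀ v : Site 2, triNorm v ≤ 2 * (m : ℤ) → (v ∈ frameConfig i ω ↔ v ∈ frameConfig i ω') := by
    intro i hi v hv
    rw [mem_frameConfig, mem_frameConfig]
    exact hagree _ (by rw [triNorm_frameIso i hi]; exact hv)
  unfold InGoodF
  refine forall₂_congr fun i hi => ?_
  have h1 := hfr i hi
  have h2 : ∀ v : Site 2, triNorm v ≤ 2 * (m : ℤ) → (v ∈ (frameConfig i ω)ᶜ ↔ v ∈ (frameConfig i ω')ᶜ) := compl_agree h1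
  rw [inFail_congr hm hKm h1, inGuard_congr hm1 hRg h1, inGuard_congr hm2 hRg h1,
    inFail_congr hm hKm h2, inGuard_congr hm1 hRg h2, inGuard_congr hm2 hRg h2]

/-- **`InGoodF` is determined by the sites of `Λ_{2m}`.** [folklore] -/
theorem determinedBy_setOf_inGoodF {T k₀ K R₀ Kg : ℕ} (hm : 5 ≤ m) (hKm : ∀ j < K, 64 * trapScale k₀ j < m)
    (hRg : ∀ i < Kg, 32 * trapScale R₀ i ≤ m) :
    DeterminedBy {ω : SiteConfig (Site 2) | InGoodF m T k₀ K R₀ Kg ω} ↑(triBall (2 * m)) := by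
  rw [determinedBy_iff]
  intro ω ω' hω
  simp only [Set.mem_setOf_eq]
  refine inGoodF_congr hm hKm hRg fun v hv => ?_
  have key := Set.ext_iff.1 hω v
  simp only [Set.mem_inter_iff, Finset.mem_coe, mem_triBall_iff] at key
  push_cast at key
  exact ⟨fun h => (key.1 ⟨h, hv⟩).1, fun h => (key.2 ⟨h, hv⟩).1⟩

end Locality

/-! ### The step inequality -/

/-- **The internal separation step** (Nolin 2008, §4.4, p. 13:
`P(Ã̃(2^{k+i}, 2^K)) ≤ P(Ã^{η,·}(2^{k+i}, 2^K)) + 4δ · P(Ã̃(2^{k+i+1}, 2^K))`, internal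
extremities): for `m ≥ 5`, `2(2m+1) ≤ N`, `R₀ ≥ 2`, `64 k_j < m`, `32 · R₀ 32^i ≤ m` and
`4 · R₀ 32^i < m`,
`P(extTwoArm m N) ≤ P(IntTinyExt m N k₀ K R₀) + P(¬ InGoodF m …) · P(extTwoArm (2m+1) N)`:
off `InGoodF` the arms still cross from `∂Λ_{2m+1}` (`extTwoArm_mono`), an event determined by
the sites of norm `≥ 2m+1`, independent of `InGoodF` (determined by `Λ_{2m}`). [cite: Nolin2008, §4.4 (arXiv 0711.4948: proof of Thm. 10, p. 12–13)] -/
theorem real_extTwoArm_le_step {m N T k₀ K R₀ Kg : ℕ} (hm : 5 ≤ m) (hN : 2 * (2 * m + 1) ≤ N) (hR₀ : 2 ≤ R₀)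
    (hKm : ∀ j < K, 64 * trapScale k₀ j < m) (hRg : ∀ i < Kg, 32 * trapScale R₀ i ≤ m) (hRg' : ∀ i < Kg, 4 * trapScale R₀ i < m) :
    (triSitePercolation half).real (extTwoArm m N) ≤
      (triSitePercolation half).real (IntTinyExt m N k₀ K R₀) +
        (triSitePercolation half).real {ω | ¬ InGoodF m T k₀ K R₀ Kg ω} * (triSitePercolation half).real (extTwoArm (2 * m + 1) N) := by
  classical
  have hsub : extTwoArm m N ⊆ IntTinyExt m N k₀ K R₀ ∪ ({ω | ¬ InGoodF m T k₀ K R₀ Kg ω} ∩ extTwoArm (2 * m + 1) N) := by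
    intro ω hω
    by_cases hg : InGoodF m T k₀ K R₀ Kg ω
    · exact Or.inl (extTwoArm_inter_inGoodF_subset hm (by omega) hR₀ hRg' ⟨hω, hg⟩)
    · exact Or.inr ⟨hg, extTwoArm_mono (by omega) (by omega) hω⟩
  -- independence
  have dG : DeterminedBy {ω : SiteConfig (Site 2) | ¬ InGoodF m T k₀ K R₀ Kg ω} ↑(triBall (2 * m)) :=
    (determinedBy_setOf_inGoodF hm hKm hRg).compl
  have dE : DeterminedBy (extTwoArm (2 * m + 1) N) ↑((triBall (N + N / 8)).filter fun v => (2 * (m : ℤ) + 1) ≤ triNorm v) := by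
    refine (determinedBy_extTwoArm (n := 2 * m + 1) (N := N) (by omega)).mono ?_
    intro v hv
    simp only [Set.mem_setOf_eq] at hv
    simp only [Finset.mem_coe, Finset.mem_filter, mem_triBall_iff]
    push_cast at hv ⊢
    exact ⟨hv.2, hv.1⟩
  have hdisj : Disjoint (triBall (2 * m)) ((triBall (N + N / 8)).filter fun v => (2 * (m : ℤ) + 1) ≤ triNorm v) := by
    rw [Finset.disjoint_left]
    intro v hv hv'
    simp only [Finset.mem_filter, mem_triBall_iff] at hv hv'
    push_cast at hv
    omega
  have hind := sitePercolation_real_inter_of_disjoint half dG dE hdisj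
  unfold triSitePercolation at hind ⊢
  calc (sitePercolation (Site 2) half).real (extTwoArm m N)
      ≤ (sitePercolation (Site 2) half).real (IntTinyExt m N k₀ K R₀ ∪ ({ω | ¬ InGoodF m T k₀ K R₀ Kg ω} ∩ extTwoArm (2 * m + 1) N)) :=
        measureReal_mono hsub
    _ ≤ (sitePercolation (Site 2) half).real (IntTinyExt m N k₀ K R₀) +
          (sitePercolation (Site 2) half).real ({ω | ¬ InGoodF m T k₀ K R₀ Kg ω} ∩ extTwoArm (2 * m + 1) N) :=
        measureReal_union_le _ _
    _ = _ := by rw [hind]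

end Literature.Probability.Percolation
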